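import Literature.AnabelianGeometry.EtaleTheta.SettingGaloisFacts
import Literature.AnabelianGeometry.EtaleTheta.ContH1CongruenceClosedFamilies
import Literature.AnabelianGeometry.AbsoluteAnabelian.AbsTopII.PositiveSlopeHenselPolynomial
import Mathlib.NumberTheory.Padics.ProperSpace
import Mathlib.NumberTheory.LocalField.Basic
import Mathlib.Analysis.Normed.Module.FiniteDimension
import HarnessLib

/-!
# The unit group `O^×_K̈` of a theta setting: compact, `n`-th powers contain open subgroups, and hence
# «unit classes are congruence-closed» in every profinite-coefficient `H¹` ([EtTh] Rmk. 1.6.4, (Z5b) input)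

S. Mochizuki, *The étale theta function …*, Publ. RIMS **45** (2009) [EtTh], Remark 1.6.4 (PRIMS p. 252): the set of
classes "`O^×_K̈ · (η̈^Θ)^∧ ∈ H¹(Π_{Ÿ^∧}, Δ_Θ)`" on which "`Π_X/Π_{Y^∧} ≅ Ẑ ∋ a`" acts [cite: MochizukiEtTh2009, Rmk 1.6.4 p.252].
In the cell's topology-free route to the `a ∈ Ẑ` form of the action formula (abc-iut VNEXT «RMK164-(c2)-ZHAT», steps
(Z1)–(Z5); consumer abc-iut-f-128 `Discharge/Sec1Rmk164ZHatForm`) the last displayed input is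
«the unit classes `κ(O^×_K̈)` are CONGRUENCE-CLOSED»: a class congruent modulo every open normal subgroup of the
coefficient group to SOME unit class is a unit class.  abc-iut-f-142's `ContH1CongruenceClosedFamilies` §2
(`ContH1.exists_eq_of_forall_exists_rep_congr_range_of_pow`, p517305) reduces this, for ANY homomorphism `κ` from a
COMPACT group `M`, to «for every `n ≥ 1` the `n`-th powers of `M` contain an open subgroup».  THIS FILE proves that
property for `M := O^×_K̈ = ThetaSetting.unitsOKdd` of EVERY theta setting — `K̈ ⊆ ℚ̄_p` is a genuine finite extension of
`ℚ_p` in the frozen interface — and fires the knit.  Classical input: Serre, *Local Fields*, Ch. II §1 Prop. 1, §2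
Prop. 3 (a finite extension of `ℚ_p` is a non-archimedean local field; its valuation ring is a complete DVR)
[cite: SerreLocalFields1979, Ch. II §2 Prop. 3], and Hensel's lemma in the positive-slope form of [AbsTopII] Lemma 2.1
(the cell's PROVED `positiveSlopeHensel_polynomial_of_constantCoeff_mem`, abc-iut-L6-t14) [cite: MochizukiAbsTopII2013, Lemma 2.1 p.31].

PROOF-ONLY (abc-iut cell, prover abc-iut-f-142 gen 9, key (α′) «UNIT CLAUSE @ EVERY SETTING», abc-iut-L2-lead R1398;
no definition, no instance, no `Prop`-valued fact; the valuative relation on `K̈` is introduced by `letI` INSIDE proofs only):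
* §1 `exists_forall_one_add_mem_pow_eq_units_pow` — in a complete DVR `O` of characteristic zero, for every `n ≥ 1` there
  is `r ≥ 1` with `1 + 𝔪^r ⊆ (O^×)ⁿ` (positive-slope Hensel for `f = (1+X)ⁿ − 1`, then quotients of two roots);
* §2 `ThetaSetting.exists_forall_norm_sub_one_le_exists_pow_eq` — in `K̈`: every `u` with `‖u − 1‖ ≤ ‖p‖^r` is `vⁿ` with
  `‖v‖ = 1` (`K̈` is an `IsNonarchimedeanLocalField` for its OWN subtype norm from `PadicAlgCl p`: valuative topology by
  `IsValuativeTopology.of_mem_nhds_zero_iff_vle`, locally compact by `FiniteDimensional.proper ℚ_[p] K̈` with abc-iut-L2-t1's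
  `finiteDimensional_fieldKN`, non-trivial at `p`; then Mathlib infers `IsAdicComplete 𝓂[K̈] 𝒪[K̈]` and §1 applies;
  `p^r 𝒪 ⊆ 𝔪^r`); also `finiteDimensional_Kdd`, `norm_natCast_Kdd`;
* §3 `ThetaSetting.compactSpace_unitsOKdd` (THEOREM, not an instance: the unit sphere of the proper `K̈` under
  `Units.isEmbedding_val₀`) and ★ `ThetaSetting.exists_openSubgroup_unitsOKdd_subset_pow` — for every `n ≥ 1` an OPEN
  SUBGROUP of `O^×_K̈` consists of `n`-th powers (the ball `{‖u − 1‖ < ‖p‖^r}`, a subgroup by the ultrametric inequality);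
* §4 ★ `ThetaSetting.exists_eq_of_forall_exists_rep_congr_unitsOKdd` — for EVERY theta setting `D` and EVERY homomorphism
  `κ : O^×_K̈ →* ContH1 φ A H` with profinite ambient coefficients (`A` closed): a class congruent modulo every open normal
  `N` to some `κ(u_N)` (representative-congruence currency of abc-iut-f-128's `ContH1Separated`) IS some `κ(u)` — the
  (Z5b) clause, hypothesis-free, once the unit-class map is packaged as a `MonoidHom` on `↥D.unitsOKdd`.
HONEST FRAMING: classical local-field facts under OUR kernel check, over the frozen interface `ThetaSetting`
(`Kdd`, `unitsOKdd` imported, not restated); nothing of [EtTh] Remark 1.6.4 is asserted here; nothing here bears on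
[IUTchIII] Cor. 3.12; no side taken; typed ≠ proved.
-/

noncomputable section

namespace Literature.AnabelianGeometry.EtaleTheta

open IsLocalRing

/-! ### §1. In a complete DVR of characteristic zero, `n`-th powers of units contain `1 + 𝔪^r` -/

/-- In a complete discrete valuation ring `O` of characteristic zero, for every `n ≥ 1` there is `r ≥ 1` with
`1 + 𝔪^r ⊆ (O^×)ⁿ`: every `1 + c`, `c ∈ 𝔪^r`, is the `n`-th power of a unit.  Proof: the cell's positive-slope Hensel
lemma ([AbsTopII] Lemma 2.1, polynomial case, abc-iut-L6-t14 `positiveSlopeHensel_polynomial_of_constantCoeff_mem`)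
for the single polynomial `f = (1 + X)ⁿ − 1` (`f(0) = 0`, Jacobian `n(1+X)^{n-1} ≠ 0`) gives `β₀ ∈ 𝔪` and `r` with
`β₀ + 𝔪^r ⊆ f(𝔪)`; for `c ∈ 𝔪^r` both `1 + β₀ = (1+x₀)ⁿ` and `(1 + β₀)(1 + c) = (1+x₁)ⁿ`, so
`1 + c = ((1+x₁)/(1+x₀))ⁿ`. [cite: MochizukiAbsTopII2013, Lemma 2.1 p.31] -/
theorem exists_forall_one_add_mem_pow_eq_units_pow (O : Type*) [CommRing O] [IsDomain O] [IsDiscreteValuationRing O]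
    [IsAdicComplete (maximalIdeal O) O] [CharZero O] (n : ℕ) (hn : 0 < n) :
    ∃ r : ℕ, 0 < r ∧ ∀ c ∈ maximalIdeal O ^ r, ∃ v : Oˣ, (v : O) ^ n = 1 + c := by
  classical
  -- the system: one polynomial `(1 + X₀)ⁿ − 1` in one variable
  let f : Fin 1 → MvPolynomial (Fin 1) O := fun _ => (1 + MvPolynomial.X 0) ^ n - 1
  have hf0 : ∀ j, MvPolynomial.constantCoeff (f j) ∈ maximalIdeal O := by
    intro j
    simp only [f, map_sub, map_pow, map_add, map_one, MvPolynomial.constantCoeff_X, add_zero, one_pow,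
      sub_self, Ideal.zero_mem]
  have hderiv : MvPolynomial.pderiv 0 ((1 + MvPolynomial.X 0 : MvPolynomial (Fin 1) O) ^ n - 1) =
      n • (1 + MvPolynomial.X 0) ^ (n - 1) := by
    rw [map_sub, Derivation.map_one_eq_zero, sub_zero, Derivation.leibniz_pow, map_add,
      Derivation.map_one_eq_zero, zero_add, MvPolynomial.pderiv_X_self, smul_eq_mul, mul_one]
  have hS : ∃ S : Fin 1 ↪ Fin 1,
      (Matrix.of fun j k : Fin 1 => MvPolynomial.pderiv (S k) (f j)).det ≠ 0 := by
    refine ⟨Function.Embedding.refl _, ?_⟩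
    rw [Matrix.det_unique]
    change MvPolynomial.pderiv 0 ((1 + MvPolynomial.X 0 : MvPolynomial (Fin 1) O) ^ n - 1) ≠ 0
    rw [hderiv, nsmul_eq_mul]
    intro h0
    have h1 := congrArg MvPolynomial.constantCoeff h0
    simp only [map_mul, map_natCast, map_pow, map_add, map_one, MvPolynomial.constantCoeff_X, add_zero,
      one_pow, mul_one, map_zero, Nat.cast_eq_zero] at h1
    exact hn.ne' h1
  obtain ⟨β₀, r, hβ₀, hr, h⟩ :=
    Literature.AnabelianGeometry.AbsoluteAnabelian.positiveSlopeHensel_polynomial_of_constantCoeff_mem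
      O 1 1 f hf0 hS
  -- evaluation of the system
  have heval : ∀ x : Fin 1 → O, MvPolynomial.eval x (f 0) = (1 + x 0) ^ n - 1 := by
    intro x
    simp only [f, map_sub, map_pow, map_add, map_one, MvPolynomial.eval_X]
  -- `1 + m` is a unit for `m ∈ 𝔪`
  have hunit : ∀ m ∈ maximalIdeal O, IsUnit (1 + m) := by
    intro m hm
    by_contra hu
    have h1 : (1 : O) + m ∈ maximalIdeal O := (IsLocalRing.mem_maximalIdeal _).mpr hu
    have : (1 : O) ∈ maximalIdeal O := by
      have := Ideal.sub_mem _ h1 hm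
      rwa [add_sub_cancel_right] at this
    exact (maximalIdeal.isMaximal O).ne_top ((Ideal.eq_top_iff_one _).mpr this)
  refine ⟨r, hr, fun c hc => ?_⟩
  -- roots of `1 + β₀` and of `(1 + β₀)(1 + c)`
  obtain ⟨x₀, hx₀, hfx₀⟩ := h β₀ (fun j => by rw [sub_self]; exact Ideal.zero_mem _)
  obtain ⟨x₁, hx₁, hfx₁⟩ := h (fun _ => β₀ 0 + c * (1 + β₀ 0)) (fun j => by
    have hj : j = 0 := Subsingleton.elim _ _
    subst hj
    rw [add_sub_cancel_left]
    exact Ideal.mul_mem_right _ _ hc)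
  have e₀ : (1 + x₀ 0) ^ n = 1 + β₀ 0 := by
    have := hfx₀ 0
    rw [heval] at this
    linear_combination this
  have e₁ : (1 + x₁ 0) ^ n = (1 + c) * (1 + β₀ 0) := by
    have := hfx₁ 0
    rw [heval] at this
    linear_combination this
  obtain ⟨u₀, hu₀⟩ := hunit _ (hx₀ 0)
  obtain ⟨u₁, hu₁⟩ := hunit _ (hx₁ 0)
  obtain ⟨w, hw⟩ := hunit _ (hβ₀ 0)
  refine ⟨u₁ * u₀⁻¹, ?_⟩
  have hvu : ((u₁ * u₀⁻¹ : Oˣ) : O) ^ n * (u₀ : O) ^ n = (u₁ : O) ^ n := by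
    rw [← mul_pow, Units.val_mul, mul_assoc, Units.inv_mul, mul_one]
  rw [hu₀, e₀, hu₁, e₁] at hvu
  have hW : (1 + β₀ 0 : O) ≠ 0 := hw ▸ w.ne_zero
  exact mul_right_cancel₀ hW hvu


/-! ### §2. `K̈` is a non-archimedean local field for its own absolute value; `n`-th roots near `1` in `K̈` -/

namespace ThetaSetting

open ValuativeRel

variable {p : ℕ} [Fact p.Prime] (D : ThetaSetting p)

/-- `K̈ = K(√−1·?, q̈)`-type level-`2` field of the setting is a finite extension of `ℚ_p` (abc-iut-L2-t1
`finiteDimensional_fieldKN` with `finiteDimensional_K`). [cite: MochizukiEtTh2009, §1 p.17] -/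
theorem finiteDimensional_Kdd : FiniteDimensional ℚ_[p] D.Kdd := by
  haveI := D.finiteDimensional_K
  exact finiteDimensional_fieldKN D.K D.qX 2

/-- The norm of `K̈ ⊆ ℚ̄_p` is the restriction of the norm of `ℚ̄_p` ("`K̈`", p. 17, inside the fixed `ℚ̄_p` of the
setting). [cite: MochizukiEtTh2009, §1 p.17] -/
theorem norm_coe_Kdd (x : D.Kdd) : ‖(x : PadicAlgCl p)‖ = ‖x‖ := rfl

/-- `‖p‖ = p⁻¹` in `K̈ ⊆ ℚ̄_p` (the absolute value of `ℚ̄_p` extends that of `ℚ_p`). [cite: MochizukiEtTh2009, §1 p.17] -/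
theorem norm_natCast_Kdd : ‖(p : D.Kdd)‖ = (p : ℝ)⁻¹ := by
  change ‖((p : D.Kdd) : PadicAlgCl p)‖ = _
  have h : ((p : D.Kdd) : PadicAlgCl p) = ((p : ℚ_[p]) : PadicAlgCl p) := by
    push_cast; rfl
  rw [h, PadicAlgCl.norm_extends, Padic.norm_p]

/-- `0 < ‖p‖ < 1` in `K̈ ⊆ ℚ̄_p`. [cite: MochizukiEtTh2009, §1 p.17] -/
theorem norm_natCast_Kdd_pos_lt_one : 0 < ‖(p : D.Kdd)‖ ∧ ‖(p : D.Kdd)‖ < 1 := by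
  have h1 : (1 : ℝ) < p := by exact_mod_cast (Fact.out : p.Prime).one_lt
  rw [D.norm_natCast_Kdd]
  exact ⟨inv_pos.mpr (zero_lt_one.trans h1), inv_lt_one_of_one_lt₀ h1⟩

/-- **`n`-th roots near `1` in `K̈`**: for every `n ≥ 1` there is `r ≥ 1` such that every `u ∈ K̈` with
`‖u − 1‖ ≤ ‖p‖^r` is `vⁿ` for some `v ∈ K̈` with `‖v‖ = 1`.  Proof: `K̈` with its absolute value (restricted from `ℚ̄_p`)
is a non-archimedean local field (valuative topology from the norm, locally compact as a finite-dimensional normed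
space over `ℚ_p`, non-trivially valued), so its valuation ring `𝒪_K̈` is a complete discrete valuation ring (Mathlib
`IsNonarchimedeanLocalField`); apply §1 to `𝒪_K̈` and note `p^r 𝒪_K̈ ⊆ 𝔪^r`. [cite: SerreLocalFields1979, Ch. II §2 Prop. 3]
[cite: MochizukiAbsTopII2013, Lemma 2.1 p.31] -/
theorem exists_forall_norm_sub_one_le_exists_pow_eq (n : ℕ) (hn : 0 < n) :
    ∃ r : ℕ, 0 < r ∧ ∀ u : D.Kdd, ‖u - 1‖ ≤ ‖(p : D.Kdd)‖ ^ r → ∃ v : D.Kdd, ‖v‖ = 1 ∧ v ^ n = u := by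
  classical
  letI : ValuativeRel D.Kdd := ValuativeRel.ofValuation (NormedField.valuation (K := D.Kdd))
  haveI hcompat : (NormedField.valuation (K := D.Kdd)).Compatible := Valuation.Compatible.ofValuation _
  obtain ⟨hp0, hp1⟩ := D.norm_natCast_Kdd_pos_lt_one
  -- `K̈` is a non-archimedean local field for this structure
  haveI : IsNonarchimedeanLocalField D.Kdd := by
    haveI : IsValuativeTopology D.Kdd := by
      letI : Valued D.Kdd NNReal := NormedField.toValued
      exact IsValuativeTopology.of_mem_nhds_zero_iff_vle (v := NormedField.valuation (K := D.Kdd))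
        Valued.mem_nhds_zero
    haveI : LocallyCompactSpace D.Kdd := by
      haveI := D.finiteDimensional_Kdd
      haveI : ProperSpace D.Kdd := FiniteDimensional.proper ℚ_[p] D.Kdd
      infer_instance
    haveI : ValuativeRel.IsNontrivial D.Kdd := by
      rw [ValuativeRel.isNontrivial_iff_isNontrivial (NormedField.valuation (K := D.Kdd))]
      refine ⟨(p : D.Kdd), ?_, ?_⟩
      · intro h
        have := congrArg (fun t : NNReal => (t : ℝ)) h
        simp only [NormedField.valuation_apply, coe_nnnorm, NNReal.coe_zero] at this
        exact hp0.ne' this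
      · intro h
        have := congrArg (fun t : NNReal => (t : ℝ)) h
        simp only [NormedField.valuation_apply, coe_nnnorm, NNReal.coe_one] at this
        exact hp1.ne this
    exact {}
  -- dictionary between the valuation ring and the norm
  have hmem : ∀ x : D.Kdd, x ∈ 𝒪[D.Kdd] ↔ ‖x‖ ≤ 1 := by
    intro x
    rw [Valuation.mem_integer_iff, ← (valuation D.Kdd).map_one, ← Valuation.vle_iff_le,
      Valuation.vle_iff_le (v := NormedField.valuation (K := D.Kdd)), map_one,
      NormedField.valuation_apply, ← NNReal.coe_le_coe, coe_nnnorm, NNReal.coe_one]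
  have hunit : ∀ v : (𝒪[D.Kdd])ˣ, ‖((v : 𝒪[D.Kdd]) : D.Kdd)‖ = 1 := by
    intro v
    have h1 := (Valuation.integer.integers (valuation D.Kdd)).isUnit_iff_valuation_eq_one.mp v.isUnit
    have h2 : (valuation D.Kdd) ((v : 𝒪[D.Kdd]) : D.Kdd) ≤ (valuation D.Kdd) 1 ∧
        (valuation D.Kdd) 1 ≤ (valuation D.Kdd) ((v : 𝒪[D.Kdd]) : D.Kdd) := by
      rw [map_one]; exact ⟨h1.le, h1.ge⟩
    rw [← Valuation.vle_iff_le, ← Valuation.vle_iff_le,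
      Valuation.vle_iff_le (v := NormedField.valuation (K := D.Kdd)),
      Valuation.vle_iff_le (v := NormedField.valuation (K := D.Kdd)), map_one,
      NormedField.valuation_apply] at h2
    apply le_antisymm
    · have := h2.1; rwa [← NNReal.coe_le_coe, coe_nnnorm, NNReal.coe_one] at this
    · have := h2.2; rwa [← NNReal.coe_le_coe, coe_nnnorm, NNReal.coe_one] at this
  have hpO : (p : D.Kdd) ∈ 𝒪[D.Kdd] := (hmem _).mpr hp1.le
  have hpm : (⟨(p : D.Kdd), hpO⟩ : 𝒪[D.Kdd]) ∈ 𝓂[D.Kdd] := by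
    rw [IsLocalRing.mem_maximalIdeal, mem_nonunits_iff, Valuation.Integer.not_isUnit_iff_valuation_lt_one]
    change valuation D.Kdd (p : D.Kdd) < 1
    rw [← (valuation D.Kdd).map_one, ← Valuation.vlt_iff_lt,
      Valuation.vlt_iff_lt (v := NormedField.valuation (K := D.Kdd)), map_one, NormedField.valuation_apply,
      ← NNReal.coe_lt_coe, coe_nnnorm, NNReal.coe_one]
    exact hp1
  -- §1 in the complete DVR `𝒪_K̈`
  obtain ⟨r, hr, h⟩ := exists_forall_one_add_mem_pow_eq_units_pow 𝒪[D.Kdd] n hn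
  refine ⟨r, hr, fun u hu => ?_⟩
  -- `c := u - 1 = p^r · d` with `‖d‖ ≤ 1`, so `c ∈ 𝔪^r`
  have hpr0 : ((p : D.Kdd)) ^ r ≠ 0 := pow_ne_zero _ (norm_pos_iff.mp hp0)
  set c : D.Kdd := u - 1 with hc
  have hd : ‖c / (p : D.Kdd) ^ r‖ ≤ 1 := by
    rw [norm_div, norm_pow, div_le_one (pow_pos hp0 r)]
    exact hu
  have hc1 : ‖c‖ ≤ 1 := hu.trans (pow_le_one₀ hp0.le hp1.le)
  have hcO : c ∈ 𝒪[D.Kdd] := (hmem _).mpr hc1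
  have hdO : c / (p : D.Kdd) ^ r ∈ 𝒪[D.Kdd] := (hmem _).mpr hd
  have hcm : (⟨c, hcO⟩ : 𝒪[D.Kdd]) ∈ 𝓂[D.Kdd] ^ r := by
    have heq : (⟨c, hcO⟩ : 𝒪[D.Kdd]) = (⟨(p : D.Kdd), hpO⟩ : 𝒪[D.Kdd]) ^ r * ⟨c / (p : D.Kdd) ^ r, hdO⟩ := by
      apply Subtype.ext
      change c = (p : D.Kdd) ^ r * (c / (p : D.Kdd) ^ r)
      rw [mul_div_cancel₀ _ hpr0]
    rw [heq]
    exact Ideal.mul_mem_right _ _ (Ideal.pow_mem_pow hpm r)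
  obtain ⟨v, hv⟩ := h _ hcm
  refine ⟨((v : 𝒪[D.Kdd]) : D.Kdd), hunit v, ?_⟩
  have hv' := congrArg (fun t : 𝒪[D.Kdd] => (t : D.Kdd)) hv
  simp only [SubmonoidClass.coe_pow] at hv'
  change ((v : 𝒪[D.Kdd]) : D.Kdd) ^ n = 1 + c at hv'
  rw [hv', hc, add_sub_cancel]

/-! ### §3. The unit group `O^×_K̈` of the setting: compact, and `n`-th powers contain an open subgroup -/

/-- Membership in `O^×_K̈` (`unitsOKdd`), in terms of the norm of `K̈`. [cite: MochizukiEtTh2009, §1 p.17] -/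
theorem mem_unitsOKdd_iff (u : (D.Kdd)ˣ) : u ∈ D.unitsOKdd ↔ ‖(u : D.Kdd)‖ = 1 := Iff.rfl

/-- **`O^×_K̈` is compact** (the unit sphere of the finite extension `K̈/ℚ_p`, a proper normed space; the units of a
normed field carry the embedded topology).  A theorem, not an instance. [cite: SerreLocalFields1979, Ch. II §1 Prop. 1] -/
theorem compactSpace_unitsOKdd : CompactSpace D.unitsOKdd := by
  haveI := D.finiteDimensional_Kdd
  haveI : ProperSpace D.Kdd := FiniteDimensional.proper ℚ_[p] D.Kdd
  have hset : Units.val '' (D.unitsOKdd : Set (D.Kdd)ˣ) = Metric.sphere (0 : D.Kdd) 1 := by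
    ext x
    simp only [Set.mem_image, SetLike.mem_coe, mem_unitsOKdd_iff, mem_sphere_iff_norm, sub_zero]
    constructor
    · rintro ⟨u, hu, rfl⟩
      exact hu
    · intro hx
      have hx0 : x ≠ 0 := norm_pos_iff.mp (by rw [hx]; exact one_pos)
      exact ⟨Units.mk0 x hx0, hx, rfl⟩
  have hc : IsCompact (D.unitsOKdd : Set (D.Kdd)ˣ) := by
    rw [Units.isEmbedding_val₀.isCompact_iff, hset]
    exact isCompact_sphere 0 1
  exact isCompact_iff_compactSpace.mp hc

/-- **In `O^×_K̈` the `n`-th powers contain an open subgroup**, for every `n ≥ 1`: the subgroup `{‖u − 1‖ < ‖p‖^r}`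
(a subgroup by the ultrametric inequality, open in the units topology) for the `r` of
`exists_forall_norm_sub_one_le_exists_pow_eq`. [cite: SerreLocalFields1979, Ch. II §2 Prop. 3]
[cite: MochizukiAbsTopII2013, Lemma 2.1 p.31] -/
theorem exists_openSubgroup_unitsOKdd_subset_pow (n : ℕ) (hn : 0 < n) :
    ∃ W : OpenSubgroup D.unitsOKdd, ∀ w ∈ W, ∃ v : D.unitsOKdd, v ^ n = w := by
  obtain ⟨r, -, hroot⟩ := D.exists_forall_norm_sub_one_le_exists_pow_eq n hn
  obtain ⟨hp0, -⟩ := D.norm_natCast_Kdd_pos_lt_one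
  set δ : ℝ := ‖(p : D.Kdd)‖ ^ r with hδdef
  have hδ : 0 < δ := pow_pos hp0 r
  -- the norm of a member of `O^×_K̈` is `1`
  have hnorm : ∀ w : D.unitsOKdd, ‖(((w : (D.Kdd)ˣ) : D.Kdd))‖ = 1 := fun w => (D.mem_unitsOKdd_iff _).mp w.2
  have hcont : Continuous fun w : D.unitsOKdd => ‖(((w : (D.Kdd)ˣ) : D.Kdd)) - 1‖ :=
    ((Units.continuous_val.comp continuous_subtype_val).sub continuous_const).norm
  let W : OpenSubgroup D.unitsOKdd :=
    { carrier := {w | ‖(((w : (D.Kdd)ˣ) : D.Kdd)) - 1‖ < δ}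
      mul_mem' := by
        intro a b ha hb
        simp only [Set.mem_setOf_eq] at ha hb ⊢
        have hsplit : (((a * b : D.unitsOKdd) : (D.Kdd)ˣ) : D.Kdd) - 1 =
            ((a : (D.Kdd)ˣ) : D.Kdd) * ((((b : (D.Kdd)ˣ) : D.Kdd)) - 1) + ((((a : (D.Kdd)ˣ) : D.Kdd)) - 1) := by
          simp only [Subgroup.coe_mul, Units.val_mul]
          ring
        rw [hsplit]
        refine (IsUltrametricDist.norm_add_le_max _ _).trans_lt (max_lt ?_ ha)
        rw [norm_mul, hnorm a, one_mul]
        exact hb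
      one_mem' := by
        simp only [Set.mem_setOf_eq, Subgroup.coe_one, Units.val_one, sub_self, norm_zero]
        exact hδ
      inv_mem' := by
        intro a ha
        simp only [Set.mem_setOf_eq] at ha ⊢
        have hsplit : (((a⁻¹ : D.unitsOKdd) : (D.Kdd)ˣ) : D.Kdd) - 1 =
            (((a⁻¹ : D.unitsOKdd) : (D.Kdd)ˣ) : D.Kdd) * (1 - ((a : (D.Kdd)ˣ) : D.Kdd)) := by
          rw [mul_sub, mul_one, Subgroup.coe_inv, Units.val_inv_eq_inv_val, inv_mul_cancel₀ (a : (D.Kdd)ˣ).ne_zero]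
        rw [hsplit, norm_mul, hnorm a⁻¹, one_mul, norm_sub_rev]
        exact ha
      isOpen' := isOpen_lt hcont continuous_const }
  refine ⟨W, fun w hw => ?_⟩
  have hw' : ‖(((w : (D.Kdd)ˣ) : D.Kdd)) - 1‖ ≤ ‖(p : D.Kdd)‖ ^ r := le_of_lt hw
  obtain ⟨v, hv1, hvn⟩ := hroot _ hw'
  have hv0 : v ≠ 0 := norm_pos_iff.mp (by rw [hv1]; exact one_pos)
  refine ⟨⟨Units.mk0 v hv0, (D.mem_unitsOKdd_iff _).mpr hv1⟩, ?_⟩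
  apply Subtype.ext
  apply Units.ext
  simp only [Subgroup.coe_pow, Units.val_pow_eq_pow_val, Units.val_mk0]
  exact hvn

/-! ### §4. The knit with `ContH1CongruenceClosedFamilies` §2: unit classes are congruence-closed, at EVERY setting -/

/-- **[EtTh] Rmk. 1.6.4, (Z5b) input «the unit classes `κ(O^×_K̈)` are congruence-closed» — DISCHARGED for every
`ThetaSetting` and every homomorphism `κ : O^×_K̈ → H¹`** (profinite ambient coefficients, `A` closed): a class congruent
modulo every open normal `N ⊴ G′` to some `κ(u_N)`, `u_N ∈ O^×_K̈` (representative-congruence currency of abc-iut-f-128's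
`ContH1Separated`), IS `κ(u)` for some `u ∈ O^×_K̈` — by abc-iut-f-142's
`ContH1.exists_eq_of_forall_exists_rep_congr_range_of_pow` (p517305) with §3: `O^×_K̈` is compact and its `n`-th powers
contain open subgroups.  (Used with `κ :=` the Kummer map of `EtaleThetaData.kumYdd ∘ toKddHat` on `O^×_K̈` composed
with the hat-class maps of Rmk. 1.6.4, packaged by the consumer.) [cite: MochizukiEtTh2009, Rmk 1.6.4 p.252]
[cite: NeukirchSchmidtWingberg2008, I §2 and II §7] -/
theorem exists_eq_of_forall_exists_rep_congr_unitsOKdd {G G' : Type*} [Group G] [TopologicalSpace G]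
    [Group G'] [TopologicalSpace G'] [IsTopologicalGroup G'] {φ : G →* G'} {A : Subgroup G'} [A.Normal]
    [IsMulCommutative A] {H : Subgroup G} [CompactSpace G'] [T2Space G'] [TotallyDisconnectedSpace G']
    (hA : IsClosed (A : Set G')) (κ : D.unitsOKdd →* ContH1 φ A H) (x : ContH1 φ A H)
    (hx : ∀ N : OpenNormalSubgroup G', ∃ u : D.unitsOKdd, ∃ f g : contCocycles φ A H,
      (QuotientGroup.mk f : ContH1 φ A H) = x ∧ (QuotientGroup.mk g : ContH1 φ A H) = κ u ∧
        ∀ h : H, ((f.1 h : A) : G') * (((g.1 h : A) : G'))⁻¹ ∈ N.toSubgroup) :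
    ∃ u : D.unitsOKdd, x = κ u := by
  haveI := D.compactSpace_unitsOKdd
  exact ContH1.exists_eq_of_forall_exists_rep_congr_range_of_pow hA κ
    (fun n hn => D.exists_openSubgroup_unitsOKdd_subset_pow n hn) x hx

end ThetaSetting

end Literature.AnabelianGeometry.EtaleTheta

end
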